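import Literature.AlgebraicGeometry.Motives.FaltingsECSemisimpleProofs
import Literature.NumberTheory.EllipticCurves.FrobeniusManinProofs
import HarnessLib

/-!
# Tate's semisimplicity theorem for `V_ℓ E` over a finite field: the discharge

Topic `AlgebraicGeometry/Motives`; sibling of `Literature.AlgebraicGeometry.Motives.FaltingsEC` and
`…FaltingsECSemisimpleProofs`. **Proves the named fact
`Literature.AlgebraicGeometry.Motives.isSemisimpleRepresentation_rationalGaloisRepTate_of_finite`** (Tate, *Invent. Math.* 2
(1966), Main Theorem and §2: for an elliptic curve `E` over a finite field `k` and every prime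
`ℓ`, the `ℚ_ℓ[Γ_k]`-module `V_ℓ E` is semisimple):
`Literature.AlgebraicGeometry.Motives.isSemisimpleRepresentation_rationalGaloisRepTate_of_finite_holds`.

The `ℓ`-adic and Galois-theoretic assembly (Tate's §1–2: `Γ_k` is topologically generated by the
arithmetic Frobenius `σ_q`; `σ_q`-stable subspaces of `V_ℓ E` are `Γ_k`-stable by density and
Krull; `ℤ[π]` is a domain, so the minimal relation of `π` is separable and `ρ(σ_q) = V_ℓ(π)` is
semisimple) is `isSemisimpleRepresentation_rationalGaloisRepTate_of_exists_aeval_eq_zero` of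
`FaltingsECSemisimpleProofs`. Its single geometric input — the Frobenius endomorphism `π` is
algebraic over `ℤ` — is supplied by `WeierstrassCurve.aeval_frobeniusIsogeny_eq_zero` of
`Literature.NumberTheory.EllipticCurves.FrobeniusManinProofs`: **`π² - aπ + q = 0` in `End_k(E)`**
(Silverman, *AEC*, Thm. V.2.3.1(b)), proved there elementarily by Manin's degree method. Also
recorded: the same relation for `φ_ℓ = ρ_ℓ(σ_q)` on every Tate module `T_ℓ E`
(`WeierstrassCurve.aeval_galoisRepTate_frobenius_eq_zero`, unconditional form of
`galoisRepTate_frobenius_sq_sub_add` of `FrobeniusTateModule`).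

## References

* [Tate1966Endomorphisms] J. Tate, *Endomorphisms of abelian varieties over finite fields*,
  Invent. Math. 2 (1966), 134–144: Main Theorem; §2 (`F = ℚ[π]` is semisimple, `π` acts
  semisimply on `V_ℓ`).
* [SilvermanAEC2009] J. H. Silverman, *The Arithmetic of Elliptic Curves*, 2nd ed., GTM 106,
  Springer 2009: Thm. V.2.3.1(b).

## Design

Theorems only; `noncomputable section`; namespaces `WeierstrassCurve` (dot-notation extension)
and `Literature.Hodge` as in the siblings.
-/

noncomputable section

open scoped Classical

universe u

namespace WeierstrassCurve

open Polynomial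

variable {k : Type u} [Field k] [Finite k] (W : WeierstrassCurve k) [W.IsElliptic]
  {σ : Field.absoluteGaloisGroup k} (ℓ : ℕ) [Fact ℓ.Prime]

/-- **`φ_ℓ² - aφ_ℓ + q = 0` on `T_ℓ E`, every prime `ℓ`** (`a = q + 1 - #E(k)`): the image under
the ring map `End_k(E) → End(T_ℓ E)` (`Literature.AlgebraicGeometry.Motives.tateEndRingHom`, which sends `π ↦ ρ_ℓ(σ_q)`,
`tateEndRingHom_frobenius`) of `π² - aπ + q = 0` in `End_k(E)`
(`aeval_frobeniusIsogeny_eq_zero`). Silverman, *AEC*, V.§2 (proof of Thm. V.2.3.1, read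
backwards). [cite: SilvermanAEC2009, Thm. V.2.3.1(b)] -/
theorem aeval_galoisRepTate_frobenius_eq_zero
    (hσ : ∀ x : AlgebraicClosure k, σ • x = x ^ Nat.card k) :
    Polynomial.aeval (W.galoisRepTate ℓ σ)
      (X ^ 2 - C ((Nat.card k : ℤ) + 1 - Nat.card W.toAffine.Point) * X + C (Nat.card k : ℤ)) =
        0 := by
  have h := congrArg (Literature.AlgebraicGeometry.Motives.tateEndRingHom W ℓ) (W.aeval_frobeniusIsogeny_eq_zero hσ)
  rw [map_zero, show Literature.AlgebraicGeometry.Motives.tateEndRingHom W ℓ (Polynomial.aeval _ _) =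
      (Literature.AlgebraicGeometry.Motives.tateEndRingHom W ℓ).toIntAlgHom (Polynomial.aeval _ _) from rfl,
    ← Polynomial.aeval_algHom_apply] at h
  rwa [show (Literature.AlgebraicGeometry.Motives.tateEndRingHom W ℓ).toIntAlgHom
      ⟨(W.frobeniusIsogeny hσ).toAddMonoidHom, (W.frobeniusIsogeny hσ).toAddMonoidHom_mem_endRing⟩ =
      W.galoisRepTate ℓ σ from tateEndRingHom_frobenius W ℓ hσ] at h

end WeierstrassCurve

namespace Literature.AlgebraicGeometry.Motives

open WeierstrassCurve Polynomial

variable {K : Type u} [Field K] (W : WeierstrassCurve K) (ℓ : ℕ) [Fact ℓ.Prime]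

/-- **Discharge of the named fact `isSemisimpleRepresentation_rationalGaloisRepTate_of_finite`**
(Tate, *Invent. Math.* 2 (1966), Main Theorem / Thm. 2: for an elliptic curve `E` over a finite
field `k` and every prime `ℓ`, `V_ℓ E` is a semisimple `ℚ_ℓ[Γ_k]`-module). The `ℓ`-adic and
Galois-theoretic assembly is `isSemisimpleRepresentation_rationalGaloisRepTate_of_exists_aeval_eq_zero`
of `FaltingsECSemisimpleProofs` (Tate's §1–2: density of Frobenius, Krull, separability of the
minimal relation of `π` in the domain `ℤ[π]`); its one geometric input, that the Frobenius
endomorphism `π` is algebraic over `ℤ`, is `aeval_frobeniusIsogeny_eq_zero`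
(`π² - aπ + q = 0`, Silverman V.2.3.1(b), proved in `EllipticCurves/FrobeniusManinProofs` by Manin's
elementary method).
[cite: Tate1966Endomorphisms, Main Theorem and §2 (π acts semisimply on V_ℓ)] -/
theorem isSemisimpleRepresentation_rationalGaloisRepTate_of_finite_holds :
    isSemisimpleRepresentation_rationalGaloisRepTate_of_finite W ℓ := by
  intro _ _
  obtain ⟨σ, hσ⟩ := exists_frobenius_absoluteGaloisGroup K
  exact isSemisimpleRepresentation_rationalGaloisRepTate_of_exists_aeval_eq_zero W ℓ hσ
    ⟨_, X_sq_sub_C_mul_X_add_C_ne_zero _ _, W.aeval_frobeniusIsogeny_eq_zero hσ⟩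

end Literature.AlgebraicGeometry.Motives
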